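import Mathlib
import Summits.KontsevichZagierPeriods.Zeta5Search.ResidueLaw
import Summits.KontsevichZagierPeriods.Zeta5Search.PolynomialResidues
import HarnessLib

/-!
# ζ(5) search — PROOF of gen-2 g11's RESIDUE IDENTITY `ResidueLaw.ResidueIdentity` (REPORT-gen2-g11 §2, "THEOREM R")

HONEST FRAMING: systematic search; no irrationality claim unless certified.

Cell `pub-zeta5`, prover seat p3 (gen 2).  `theorem residueIdentity_holds : ResidueIdentity` — the abstract residue identity of
`Zeta5Search/ResidueLaw.lean` §1 is now a THEOREM (it was filed as an `@[conjecture]` obligation, p237302):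
for a prime `p ≥ 3`, `M ≥ 2`, `E : ℕ → ℤ` with `E_y ≥ −M` (`y < p`) and `h ∈ F_p[t]` with `deg h + p(M−2) + Σ_{y<p} E_y ≤ −2`,
`Σ_{E_x=−M} (h'(−x)ḡ_x + h(−x)ḡ_xφ̄_x) + Σ_{E_x=−M+1} h(−x)ḡ_x = 0` in `ZMod p`
(`ḡ_x = ∏_{y≠x}(y−x)^{E_y}`, `φ̄_x = Σ_{y≠x} E_y/(y−x)`, i.e. `gBarE`, `phiBarE`).

PROOF (the paper proof of REPORT §2, made algebraic).  Put `e_y = E_y + M − 2 ≥ −2` and split the residues `y < p` into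
`T = {e_y ≥ 0}` and `S = {e_y < 0}`; let `A = h·∏_{y∈T}(X + y)^{e_y}` and `B = ∏_{x∈S}(X + x)^{−e_x}` (pole orders `−e_x ∈ {1,2}`),
so that `A/B = h·∏_{y<p}(X+y)^{E_y}·(X^p − X)^{M−2}` and `deg A − deg B = deg h + Σ_y e_y ≤ −2`.  The algebraic residue theorem
`PolynomialResidues.sum_res_eq_zero` (previous file; Mathlib partial fractions) gives `Σ_{x∈S} Res_{−x}(A/B) = 0`.  The residue
at `−x` is computed from the logarithmic derivatives of the two products (`eval_derivative_prod_pow_X_sub_C`):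
`Res = (P/C)(−x)·(h'(−x) + h(−x)·Σ_{y≠x} e_y/(y−x))` for a double pole and `(P/C)(−x)·h(−x)` for a simple pole, where
`(P/C)(−x) = ∏_{y≠x}(y−x)^{e_y} = ḡ_x·(∏_{y≠x}(y−x))^{M−2} = (−1)^{M−2}ḡ_x` by WILSON (`ZMod.prod_Ico_one_prime`, reindexed:
`prod_range_erase_sub_eq_neg_one`) and `Σ_{y≠x} e_y/(y−x) = φ̄_x + (M−2)Σ_{y≠x}(y−x)⁻¹ = φ̄_x` because `Σ_{z∈F_p} z⁻¹ = Σ z = 0` for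
`p ≥ 3` (`FiniteField.sum_pow_lt_card_sub_one`; `sum_range_erase_inv_sub_eq_zero`).  Dividing by the unit `(−1)^{M−2}` gives the claim.
Nothing here bears on irrationality; no new statements.
-/

open Finset Polynomial

namespace Summit.KontsevichZagierPeriods.Zeta5Search.ResidueLaw

open Summit.KontsevichZagierPeriods.Zeta5Search.PolynomialResidues

/-! ## Finite-field sums over the residues `y < p`, `y ≠ x` -/

section ZModSums

variable {p : ℕ} [Fact p.Prime]

/-- Reindexing a product over the residues `y < p`, `y ≠ x` (as naturals) to a product over `ZMod p ∖ {x}`. -/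
theorem prod_range_erase_eq_prod_univ_erase {β : Type*} [CommMonoid β] (f : ZMod p → β) {x : ℕ} (hx : x < p) :
    ∏ y ∈ (range p).erase x, f (y : ZMod p) = ∏ z ∈ (univ : Finset (ZMod p)).erase (x : ZMod p), f z := by
  refine Finset.prod_nbij' (fun y : ℕ => (y : ZMod p)) (fun z => z.val) ?_ ?_ ?_ ?_ (fun _ _ => rfl)
  · intro y hy
    obtain ⟨hyx, hyp⟩ := Finset.mem_erase.1 hy
    refine Finset.mem_erase.2 ⟨fun h => hyx ?_, Finset.mem_univ _⟩
    have h' := congrArg ZMod.val h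
    rwa [ZMod.val_cast_of_lt (Finset.mem_range.1 hyp), ZMod.val_cast_of_lt hx] at h'
  · intro z hz
    obtain ⟨hzx, -⟩ := Finset.mem_erase.1 hz
    refine Finset.mem_erase.2 ⟨fun h => hzx ?_, Finset.mem_range.2 (ZMod.val_lt z)⟩
    rw [← ZMod.natCast_zmod_val z, h]
  · intro y hy
    exact ZMod.val_cast_of_lt (Finset.mem_range.1 (Finset.mem_erase.1 hy).2)
  · intro z _
    exact ZMod.natCast_zmod_val z

/-- Additive version of `prod_range_erase_eq_prod_univ_erase`. -/
theorem sum_range_erase_eq_sum_univ_erase {β : Type*} [AddCommMonoid β] (f : ZMod p → β) {x : ℕ} (hx : x < p) :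
    ∑ y ∈ (range p).erase x, f (y : ZMod p) = ∑ z ∈ (univ : Finset (ZMod p)).erase (x : ZMod p), f z := by
  refine Finset.sum_nbij' (fun y : ℕ => (y : ZMod p)) (fun z => z.val) ?_ ?_ ?_ ?_ (fun _ _ => rfl)
  · intro y hy
    obtain ⟨hyx, hyp⟩ := Finset.mem_erase.1 hy
    refine Finset.mem_erase.2 ⟨fun h => hyx ?_, Finset.mem_univ _⟩
    have h' := congrArg ZMod.val h
    rwa [ZMod.val_cast_of_lt (Finset.mem_range.1 hyp), ZMod.val_cast_of_lt hx] at h'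
  · intro z hz
    obtain ⟨hzx, -⟩ := Finset.mem_erase.1 hz
    refine Finset.mem_erase.2 ⟨fun h => hzx ?_, Finset.mem_range.2 (ZMod.val_lt z)⟩
    rw [← ZMod.natCast_zmod_val z, h]
  · intro y hy
    exact ZMod.val_cast_of_lt (Finset.mem_range.1 (Finset.mem_erase.1 hy).2)
  · intro z _
    exact ZMod.natCast_zmod_val z

/-- WILSON, translated: `∏_{y < p, y ≠ x} (y − x) = −1` in `ZMod p` (`x < p`). -/
theorem prod_range_erase_sub_eq_neg_one {x : ℕ} (hx : x < p) :
    ∏ y ∈ (range p).erase x, ((y : ZMod p) - (x : ZMod p)) = -1 := by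
  rw [prod_range_erase_eq_prod_univ_erase (fun z => z - (x : ZMod p)) hx]
  have h1 : ∏ z ∈ (univ : Finset (ZMod p)).erase (x : ZMod p), (z - (x : ZMod p))
      = ∏ w ∈ (univ : Finset (ZMod p)).erase 0, w := by
    refine Finset.prod_nbij' (fun z => z - (x : ZMod p)) (fun w => w + (x : ZMod p)) ?_ ?_ ?_ ?_
      (fun _ _ => rfl)
    · intro z hz
      exact Finset.mem_erase.2 ⟨sub_ne_zero.2 (Finset.mem_erase.1 hz).1, Finset.mem_univ _⟩
    · intro w hw
      refine Finset.mem_erase.2 ⟨fun h => (Finset.mem_erase.1 hw).1 ?_, Finset.mem_univ _⟩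
      simpa using h
    · intro z _
      simp
    · intro w _
      simp
  rw [h1]
  have h2 := prod_range_erase_eq_prod_univ_erase (fun z : ZMod p => z) (Fact.out : p.Prime).pos
  rw [Nat.cast_zero] at h2
  rw [← h2]
  have h3 : (range p).erase 0 = Ico 1 p := by
    ext y
    simp only [Finset.mem_erase, Finset.mem_range, Finset.mem_Ico]
    omega
  rw [h3]
  exact ZMod.prod_Ico_one_prime p

/-- `Σ_{y < p, y ≠ x} (y − x)⁻¹ = 0` in `ZMod p` for a prime `p ≥ 3` (`= Σ_{z ∈ F_p} z⁻¹ = Σ_z z = 0`). -/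
theorem sum_range_erase_inv_sub_eq_zero {x : ℕ} (hx : x < p) (hp3 : 3 ≤ p) :
    ∑ y ∈ (range p).erase x, ((y : ZMod p) - (x : ZMod p))⁻¹ = 0 := by
  rw [sum_range_erase_eq_sum_univ_erase (fun z => (z - (x : ZMod p))⁻¹) hx]
  have h1 : ∑ z ∈ (univ : Finset (ZMod p)).erase (x : ZMod p), (z - (x : ZMod p))⁻¹
      = ∑ z : ZMod p, (z - (x : ZMod p))⁻¹ := by
    rw [← Finset.sum_erase_add _ _ (Finset.mem_univ (x : ZMod p)), sub_self, inv_zero, add_zero]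
  have h2 := Equiv.sum_comp (Equiv.subRight (x : ZMod p)) (fun w => w⁻¹)
  simp only [Equiv.subRight_apply] at h2
  have h3 := Equiv.sum_comp (Equiv.inv (ZMod p)) (fun w => w)
  simp only [Equiv.inv_apply] at h3
  have h4 := FiniteField.sum_pow_lt_card_sub_one (ZMod p) 1 (by rw [ZMod.card]; omega)
  simp only [pow_one] at h4
  rw [h1, h2, h3, h4]

end ZModSums

/-! ## Splitting integer powers and integer weights by sign -/

section Split

variable {K : Type*} [Field K]

/-- `z^E = z^{E⁺} · (z^{E⁻})⁻¹` (also for `z = 0`, with Lean's `0⁻¹ = 0`). -/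
theorem zpow_eq_pow_mul_pow_inv (z : K) (E : ℤ) :
    z ^ E = z ^ (max E 0).toNat * (z ^ (max (-E) 0).toNat)⁻¹ := by
  rcases le_or_gt 0 E with hE | hE
  · rw [max_eq_left hE, max_eq_right (by omega), Int.toNat_zero, pow_zero, inv_one, mul_one,
      ← zpow_natCast, Int.toNat_of_nonneg hE]
  · rw [max_eq_right hE.le, Int.toNat_zero, pow_zero, one_mul, max_eq_left (by omega),
      ← zpow_natCast, Int.toNat_of_nonneg (by omega), zpow_neg, inv_inv]

/-- A product of integer powers, split by the sign of the exponent: `∏ d_y^{e_y} = (∏_{e≥0} d_y^{k_y}) / (∏_{e<0} d_y^{m_y})`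
whenever `k = e` on `{e ≥ 0}` and `m = −e` on `{e < 0}`. -/
theorem prod_zpow_eq_div (U : Finset ℕ) (e : ℕ → ℤ) (k m : ℕ → ℕ) (d : ℕ → K)
    (hk : ∀ y ∈ U, 0 ≤ e y → (k y : ℤ) = e y) (hm : ∀ y ∈ U, e y < 0 → (m y : ℤ) = -e y) :
    ∏ y ∈ U, d y ^ e y
      = (∏ y ∈ U.filter (fun y => 0 ≤ e y), d y ^ k y) / ∏ y ∈ U.filter (fun y => e y < 0), d y ^ m y := by
  rw [← Finset.prod_filter_mul_prod_filter_not U (fun y => 0 ≤ e y), div_eq_mul_inv, ← Finset.prod_inv_distrib]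
  congr 1
  · refine Finset.prod_congr rfl fun y hy => ?_
    obtain ⟨hyU, hy0⟩ := Finset.mem_filter.1 hy
    rw [← zpow_natCast, hk y hyU hy0]
  · refine Finset.prod_congr (Finset.filter_congr fun y _ => not_le) fun y hy => ?_
    obtain ⟨hyU, hy0⟩ := Finset.mem_filter.1 hy
    rw [← zpow_natCast, hm y hyU hy0, zpow_neg, inv_inv]

/-- A sum of integer weights, split by sign: `Σ e_y/d_y = Σ_{e≥0} k_y/d_y − Σ_{e<0} m_y/d_y`. -/
theorem sum_intCast_div_eq_sub (U : Finset ℕ) (e : ℕ → ℤ) (k m : ℕ → ℕ) (d : ℕ → K)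
    (hk : ∀ y ∈ U, 0 ≤ e y → (k y : ℤ) = e y) (hm : ∀ y ∈ U, e y < 0 → (m y : ℤ) = -e y) :
    ∑ y ∈ U, ((e y : ℤ) : K) / d y
      = (∑ y ∈ U.filter (fun y => 0 ≤ e y), (k y : K) / d y) - ∑ y ∈ U.filter (fun y => e y < 0), (m y : K) / d y := by
  rw [← Finset.sum_filter_add_sum_filter_not U (fun y => 0 ≤ e y), sub_eq_add_neg, ← Finset.sum_neg_distrib]
  congr 1
  · refine Finset.sum_congr rfl fun y hy => ?_
    obtain ⟨hyU, hy0⟩ := Finset.mem_filter.1 hy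
    rw [← hk y hyU hy0, Int.cast_natCast]
  · refine Finset.sum_congr (Finset.filter_congr fun y _ => not_le) fun y hy => ?_
    obtain ⟨hyU, hy0⟩ := Finset.mem_filter.1 hy
    rw [show e y = -(m y : ℤ) by rw [hm y hyU hy0]; ring, Int.cast_neg, Int.cast_natCast, neg_div]

end Split

/-! ## The two evaluations at a pole: `∏_{y≠x}(y−x)^{e_y} = (−1)^{M−2}ḡ_x` and `Σ_{y≠x} e_y/(y−x) = φ̄_x` -/

section Evaluations

variable {p : ℕ} [Fact p.Prime]

/-- `∏_{y≠x} (y − x)^{E_y + M − 2} = (−1)^{M−2} · ḡ_x(E)` in `ZMod p` (Wilson). -/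
theorem prod_zpow_shift_eq (E : ℕ → ℤ) (M : ℕ) (hM : 2 ≤ M) {x : ℕ} (hx : x < p) :
    ∏ y ∈ (range p).erase x, ((y : ZMod p) - (x : ZMod p)) ^ (E y + (M : ℤ) - 2)
      = (-1 : ZMod p) ^ (M - 2) * gBarE p E x := by
  have hd : ∀ y ∈ (range p).erase x, (y : ZMod p) - (x : ZMod p) ≠ 0 := by
    intro y hy
    obtain ⟨hyx, hyp⟩ := Finset.mem_erase.1 hy
    refine sub_ne_zero.2 fun h => hyx ?_
    have h' := congrArg ZMod.val h
    rwa [ZMod.val_cast_of_lt (Finset.mem_range.1 hyp), ZMod.val_cast_of_lt hx] at h'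
  have hsplit : ∀ y ∈ (range p).erase x, ((y : ZMod p) - (x : ZMod p)) ^ (E y + (M : ℤ) - 2)
      = ((y : ZMod p) - (x : ZMod p)) ^ E y * ((y : ZMod p) - (x : ZMod p)) ^ (M - 2) := by
    intro y hy
    rw [show E y + (M : ℤ) - 2 = E y + ((M - 2 : ℕ) : ℤ) by omega, zpow_add₀ (hd y hy), zpow_natCast]
  rw [Finset.prod_congr rfl hsplit, Finset.prod_mul_distrib, Finset.prod_pow, prod_range_erase_sub_eq_neg_one hx,
    mul_comm]
  congr 1
  unfold gBarE
  rw [← Finset.prod_inv_distrib, ← Finset.prod_mul_distrib]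
  exact Finset.prod_congr rfl fun y _ => zpow_eq_pow_mul_pow_inv _ _

/-- `Σ_{y≠x} (E_y + M − 2)/(y − x) = φ̄_x(E)` in `ZMod p` for `p ≥ 3` (`Σ_{y≠x}(y−x)⁻¹ = 0`). -/
theorem sum_shift_div_eq (E : ℕ → ℤ) (M : ℕ) (hp3 : 3 ≤ p) {x : ℕ} (hx : x < p) :
    ∑ y ∈ (range p).erase x, (((E y + (M : ℤ) - 2 : ℤ)) : ZMod p) / ((y : ZMod p) - (x : ZMod p))
      = phiBarE p E x := by
  have h1 : ∀ y ∈ (range p).erase x, (((E y + (M : ℤ) - 2 : ℤ)) : ZMod p) / ((y : ZMod p) - (x : ZMod p))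
      = ((E y : ℤ) : ZMod p) * ((y : ZMod p) - (x : ZMod p))⁻¹
        + ((M : ZMod p) - 2) * ((y : ZMod p) - (x : ZMod p))⁻¹ := by
    intro y _
    push_cast
    ring
  rw [Finset.sum_congr rfl h1, Finset.sum_add_distrib, ← Finset.mul_sum, sum_range_erase_inv_sub_eq_zero hx hp3,
    mul_zero, add_zero]
  rfl

end Evaluations

/-! ## The theorem -/

/-- **THEOREM R (REPORT-gen2-g11 §2): the residue identity holds.**  Discharges the `@[conjecture]` obligation
`ResidueLaw.ResidueIdentity` of `Zeta5Search/ResidueLaw.lean`. -/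
theorem residueIdentity_holds : ResidueIdentity := by
  intro p M E h hp hp3 hM hE hdeg
  haveI : Fact p.Prime := ⟨hp⟩
  -- the pole set `S = {e < 0}`, the regular set `T = {e ≥ 0}`, `e_y = E_y + M − 2`
  set S : Finset ℕ := (range p).filter (fun x => E x + (M : ℤ) - 2 < 0) with hS
  set T : Finset ℕ := (range p).filter (fun x => 0 ≤ E x + (M : ℤ) - 2) with hT
  set P : (ZMod p)[X] := ∏ y ∈ T, (X - C (-((y : ℕ) : ZMod p))) ^ (E y + (M : ℤ) - 2).toNat with hP
  have hmemS : ∀ {x}, x ∈ S ↔ x < p ∧ E x + (M : ℤ) - 2 < 0 := by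
    intro x; simp only [hS, Finset.mem_filter, Finset.mem_range]
  have hmemT : ∀ {x}, x ∈ T ↔ x < p ∧ 0 ≤ E x + (M : ℤ) - 2 := by
    intro x; simp only [hT, Finset.mem_filter, Finset.mem_range]
  have hcast : ∀ {x y : ℕ}, x < p → y < p → (x : ZMod p) = (y : ZMod p) → x = y := by
    intro x y hx hy hxy
    have h' := congrArg ZMod.val hxy
    rwa [ZMod.val_cast_of_lt hx, ZMod.val_cast_of_lt hy] at h'
  have hsub : ∀ x y : ℕ, -((x : ℕ) : ZMod p) - -((y : ℕ) : ZMod p) = (y : ZMod p) - (x : ZMod p) :=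
    fun x y => neg_sub_neg _ _
  -- hypotheses of the algebraic residue theorem
  have hinj : Set.InjOn (fun x : ℕ => -((x : ℕ) : ZMod p)) (S : Set ℕ) := by
    intro x hx y hy hxy
    exact hcast (hmemS.1 (Finset.mem_coe.1 hx)).1 (hmemS.1 (Finset.mem_coe.1 hy)).1 (neg_inj.1 hxy)
  have hm12 : ∀ x ∈ S, (fun x : ℕ => (-(E x + (M : ℤ) - 2)).toNat) x = 1
      ∨ (fun x : ℕ => (-(E x + (M : ℤ) - 2)).toNat) x = 2 := by
    intro x hx
    obtain ⟨hxp, hex⟩ := hmemS.1 hx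
    have h1 := hE x hxp
    rcases (show -(E x + (M : ℤ) - 2) = 1 ∨ -(E x + (M : ℤ) - 2) = 2 by omega) with h2 | h2
    · left; simp only [h2]; rfl
    · right; simp only [h2]; rfl
  have hPdeg : P.natDegree = ∑ y ∈ T, (E y + (M : ℤ) - 2).toNat := by
    rw [hP, natDegree_prod_of_monic _ _ (fun y _ => (monic_X_sub_C _).pow _)]
    exact Finset.sum_congr rfl fun y _ => by
      rw [(monic_X_sub_C _).natDegree_pow, natDegree_X_sub_C, mul_one]
  have hAdeg : (h * P).natDegree + 2 ≤ ∑ x ∈ S, (fun x : ℕ => (-(E x + (M : ℤ) - 2)).toNat) x := by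
    have hsplit : ∑ y ∈ range p, (E y + (M : ℤ) - 2)
        = ∑ y ∈ T, (E y + (M : ℤ) - 2) + ∑ y ∈ S, (E y + (M : ℤ) - 2) := by
      rw [hT, hS, ← Finset.sum_filter_add_sum_filter_not (range p) (fun y => 0 ≤ E y + (M : ℤ) - 2)]
      congr 1
      exact Finset.sum_congr (Finset.filter_congr (fun y _ => not_le)) (fun _ _ => rfl)
    have hTsum : ∑ y ∈ T, (E y + (M : ℤ) - 2) = ∑ y ∈ T, ((E y + (M : ℤ) - 2).toNat : ℤ) :=
      Finset.sum_congr rfl fun y hy => (Int.toNat_of_nonneg (hmemT.1 hy).2).symm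
    have hSsum : ∑ y ∈ S, (E y + (M : ℤ) - 2) = -∑ y ∈ S, ((-(E y + (M : ℤ) - 2)).toNat : ℤ) := by
      rw [← Finset.sum_neg_distrib]
      exact Finset.sum_congr rfl fun y hy => by
        rw [Int.toNat_of_nonneg (by have := (hmemS.1 hy).2; omega)]; ring
    have htot : ∑ y ∈ range p, (E y + (M : ℤ) - 2) = ∑ y ∈ range p, E y + (p : ℤ) * ((M : ℤ) - 2) := by
      simp only [Finset.sum_sub_distrib, Finset.sum_add_distrib, Finset.sum_const, Finset.card_range,
        nsmul_eq_mul]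
      ring
    have hkey : ((h.natDegree : ℤ) + ∑ y ∈ T, ((E y + (M : ℤ) - 2).toNat : ℤ)) + 2
        ≤ ∑ y ∈ S, ((-(E y + (M : ℤ) - 2)).toNat : ℤ) := by
      linarith [hsplit, hSsum, htot, hTsum, hdeg]
    have hnat : h.natDegree + ∑ y ∈ T, (E y + (M : ℤ) - 2).toNat + 2
        ≤ ∑ y ∈ S, (-(E y + (M : ℤ) - 2)).toNat := by
      exact_mod_cast hkey
    refine le_trans (Nat.add_le_add_right (natDegree_mul_le.trans ?_) 2) hnat
    rw [hPdeg]
  have hres := sum_res_eq_zero S (fun x : ℕ => -((x : ℕ) : ZMod p))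
    (fun x : ℕ => (-(E x + (M : ℤ) - 2)).toNat) hinj hm12 (h * P) hAdeg
  -- the residue at each pole, in closed form
  have hterm : ∀ x ∈ S, res S (fun x : ℕ => -((x : ℕ) : ZMod p)) (fun x : ℕ => (-(E x + (M : ℤ) - 2)).toNat)
      (h * P) x = (-1 : ZMod p) ^ (M - 2) * (if E x = -(M : ℤ) then
        ((derivative h).eval (-(x : ZMod p)) * gBarE p E x + h.eval (-(x : ZMod p)) * gBarE p E x * phiBarE p E x)
        else h.eval (-(x : ZMod p)) * gBarE p E x) := by
    intro x hx
    obtain ⟨hxp, hex⟩ := hmemS.1 hx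
    have hEx := hE x hxp
    -- the relevant points are distinct from `x`
    have hzT : ∀ y ∈ T, -((x : ℕ) : ZMod p) - -((y : ℕ) : ZMod p) ≠ 0 := by
      intro y hy
      obtain ⟨hyp, hey⟩ := hmemT.1 hy
      rw [hsub]
      exact sub_ne_zero.2 fun h' => by have := hcast hyp hxp h'; subst this; omega
    have hzS : ∀ y ∈ S.erase x, -((x : ℕ) : ZMod p) - -((y : ℕ) : ZMod p) ≠ 0 := by
      intro y hy
      obtain ⟨hyx, hyS⟩ := Finset.mem_erase.1 hy
      rw [hsub]
      exact sub_ne_zero.2 fun h' => hyx (hcast (hmemS.1 hyS).1 hxp h')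
    -- values of `P`, `P'`, `C`, `C'` at `−x`
    have hPz : P.eval (-((x : ℕ) : ZMod p))
        = ∏ y ∈ T, (-((x : ℕ) : ZMod p) - -((y : ℕ) : ZMod p)) ^ (E y + (M : ℤ) - 2).toNat :=
      eval_prod_pow_X_sub_C _ _ _ _
    have hP'z : (derivative P).eval (-((x : ℕ) : ZMod p)) = P.eval (-((x : ℕ) : ZMod p))
        * ∑ y ∈ T, (((E y + (M : ℤ) - 2).toNat : ℕ) : ZMod p) / (-((x : ℕ) : ZMod p) - -((y : ℕ) : ZMod p)) := by
      rw [hPz]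
      exact eval_derivative_prod_pow_X_sub_C T _ _ _ hzT
    set Cf := cofactor S (fun x : ℕ => -((x : ℕ) : ZMod p)) (fun x : ℕ => (-(E x + (M : ℤ) - 2)).toNat) x
      with hCf
    have hCz : Cf.eval (-((x : ℕ) : ZMod p))
        = ∏ y ∈ S.erase x, (-((x : ℕ) : ZMod p) - -((y : ℕ) : ZMod p)) ^ (-(E y + (M : ℤ) - 2)).toNat :=
      eval_cofactor _ _ _ _ _
    have hC'z : (derivative Cf).eval (-((x : ℕ) : ZMod p)) = Cf.eval (-((x : ℕ) : ZMod p))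
        * ∑ y ∈ S.erase x, (((-(E y + (M : ℤ) - 2)).toNat : ℕ) : ZMod p)
            / (-((x : ℕ) : ZMod p) - -((y : ℕ) : ZMod p)) := by
      rw [hCz]
      exact eval_derivative_prod_pow_X_sub_C (S.erase x) _ _ _ hzS
    have hC0 : Cf.eval (-((x : ℕ) : ZMod p)) ≠ 0 := eval_cofactor_self_ne_zero S _ _ hinj hx
    -- `(range p) ∖ {x}` splits into `T` and `S ∖ {x}`
    have hUT : ((range p).erase x).filter (fun y => 0 ≤ E y + (M : ℤ) - 2) = T := by
      ext y
      simp only [Finset.mem_filter, Finset.mem_erase, Finset.mem_range, hT]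
      constructor
      · rintro ⟨⟨-, hyp⟩, hy⟩; exact ⟨hyp, hy⟩
      · rintro ⟨hyp, hy⟩; exact ⟨⟨by rintro rfl; omega, hyp⟩, hy⟩
    have hUS : ((range p).erase x).filter (fun y => E y + (M : ℤ) - 2 < 0) = S.erase x := by
      ext y
      simp only [Finset.mem_filter, Finset.mem_erase, Finset.mem_range, hS]
      constructor
      · rintro ⟨⟨hyx, hyp⟩, hy⟩; exact ⟨hyx, hyp, hy⟩
      · rintro ⟨hyx, hyp, hy⟩; exact ⟨⟨hyx, hyp⟩, hy⟩
    -- the quotient `P(−x)/C(−x) = (−1)^{M−2} ḡ_x`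
    have hG : P.eval (-((x : ℕ) : ZMod p)) / Cf.eval (-((x : ℕ) : ZMod p)) = (-1 : ZMod p) ^ (M - 2) * gBarE p E x := by
      rw [hPz, hCz, ← hUT, ← hUS, ← prod_zpow_eq_div ((range p).erase x) (fun y => E y + (M : ℤ) - 2)
        (fun y => (E y + (M : ℤ) - 2).toNat) (fun y => (-(E y + (M : ℤ) - 2)).toNat)
        (fun y => -((x : ℕ) : ZMod p) - -((y : ℕ) : ZMod p))
        (fun y _ hy => Int.toNat_of_nonneg hy) (fun y _ hy => Int.toNat_of_nonneg (by omega))]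
      simp only [hsub]
      exact prod_zpow_shift_eq E M hM hxp
    -- the logarithmic-derivative difference `Σ_T − Σ_{S∖x} = φ̄_x`
    have hPsi : (∑ y ∈ T, (((E y + (M : ℤ) - 2).toNat : ℕ) : ZMod p) / (-((x : ℕ) : ZMod p) - -((y : ℕ) : ZMod p)))
        - ∑ y ∈ S.erase x, (((-(E y + (M : ℤ) - 2)).toNat : ℕ) : ZMod p)
            / (-((x : ℕ) : ZMod p) - -((y : ℕ) : ZMod p)) = phiBarE p E x := by
      rw [← hUT, ← hUS, ← sum_intCast_div_eq_sub ((range p).erase x) (fun y => E y + (M : ℤ) - 2)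
        (fun y => (E y + (M : ℤ) - 2).toNat) (fun y => (-(E y + (M : ℤ) - 2)).toNat)
        (fun y => -((x : ℕ) : ZMod p) - -((y : ℕ) : ZMod p))
        (fun y _ hy => Int.toNat_of_nonneg hy) (fun y _ hy => Int.toNat_of_nonneg (by omega))]
      simp only [hsub]
      exact sum_shift_div_eq E M hp3 hxp
    -- simple or double pole
    rcases (show E x = -(M : ℤ) ∨ E x = -(M : ℤ) + 1 by omega) with hEq | hEq
    · have hmx : (fun x : ℕ => (-(E x + (M : ℤ) - 2)).toNat) x ≠ 1 := by
        show (-(E x + (M : ℤ) - 2)).toNat ≠ 1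
        rw [hEq, show -(-(M : ℤ) + (M : ℤ) - 2) = 2 by ring]
        decide
      rw [if_pos hEq, res, if_neg hmx]
      change ((derivative (h * P)).eval (-((x : ℕ) : ZMod p)) * Cf.eval (-((x : ℕ) : ZMod p))
          - (h * P).eval (-((x : ℕ) : ZMod p)) * (derivative Cf).eval (-((x : ℕ) : ZMod p)))
          / Cf.eval (-((x : ℕ) : ZMod p)) ^ 2 = _
      rw [derivative_mul, eval_add, eval_mul, eval_mul, eval_mul, hP'z, hC'z, (div_eq_iff hC0).1 hG,
        eq_add_of_sub_eq hPsi]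
      field_simp
      ring
    · have hmx : (fun x : ℕ => (-(E x + (M : ℤ) - 2)).toNat) x = 1 := by
        show (-(E x + (M : ℤ) - 2)).toNat = 1
        rw [hEq, show -(-(M : ℤ) + 1 + (M : ℤ) - 2) = 1 by ring]
        decide
      have hne : ¬ E x = -(M : ℤ) := by omega
      rw [if_neg hne, res, if_pos hmx]
      change (h * P).eval (-((x : ℕ) : ZMod p)) / Cf.eval (-((x : ℕ) : ZMod p)) = _
      rw [eval_mul, mul_div_assoc, hG]
      ring
  -- sum up: `(−1)^{M−2} · (the two sums) = Σ_S res = 0`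
  rw [Finset.sum_congr rfl hterm, ← Finset.mul_sum, Finset.sum_ite] at hres
  have hS1 : S.filter (fun x => E x = -(M : ℤ)) = (range p).filter (fun x => E x = -(M : ℤ)) := by
    ext x
    simp only [Finset.mem_filter, Finset.mem_range, hS]
    constructor
    · rintro ⟨⟨hxp, -⟩, hx⟩; exact ⟨hxp, hx⟩
    · rintro ⟨hxp, hx⟩; exact ⟨⟨hxp, by omega⟩, hx⟩
  have hS2 : S.filter (fun x => ¬ E x = -(M : ℤ)) = (range p).filter (fun x => E x = -(M : ℤ) + 1) := by
    ext x
    simp only [Finset.mem_filter, Finset.mem_range, hS]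
    constructor
    · rintro ⟨⟨hxp, hex⟩, hx⟩; have := hE x hxp; exact ⟨hxp, by omega⟩
    · rintro ⟨hxp, hx⟩; exact ⟨⟨hxp, by omega⟩, by omega⟩
  rw [hS1, hS2] at hres
  have hu : (-1 : ZMod p) ^ (M - 2) ≠ 0 := pow_ne_zero _ (neg_ne_zero.2 one_ne_zero)
  exact (mul_eq_zero.1 hres).resolve_left hu

end Summit.KontsevichZagierPeriods.Zeta5Search.ResidueLaw
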